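import Mathlib

/-!
# Subfield cell `GL₂(𝔽₁₆) ⊃ SL₂(𝔽₄)` — every embedding `SL₂(𝔽₄) ↪ GL₂(𝔽₁₆)` is standard up to the Frobenius of `𝔽₄`

**Honest framing.** A structural lemma about the finite cell `q = 4` of the skeleton line
`quadratic_extension_level_one_cell` (stub S3 `stub_subfieldCell`, crux `GradedDesignFamily`, route
`LevelGradedCohnUmans`, stmt-MatrixMultiplication-7610); it removes the "standard model" caveat from
`q = 4` cell theorems stated for `φ = mapGL` (first client: the exact wall
`subfieldCell_sixteen_wall_sharp`, file `SubfieldCellSixteenWallSharp`).  It is **not** summit progress.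

## The theorem

`embedding_conj`: for `𝔽₄ = QuadraticAlgebra (ZMod 2) 1 1`, `𝔽₁₆ = QuadraticAlgebra 𝔽₄ ⟨0,1⟩ 1`, every
injective group homomorphism `φ : SL₂(𝔽₄) →* GL₂(𝔽₁₆)` is conjugate to `mapGL` or to `mapGL ∘ Frob`:
`∃ g, ∃ τ ∈ {id, frob}, ∀ a, φ a = g · mapGL (τ a) · g⁻¹` (stated with `τ : SL₂(𝔽₄) →* SL₂(𝔽₄)`
bijective).  Unlike `q = 3` (`SubfieldCellNineEmbedding`, plain conjugacy) the Frobenius twist is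
genuinely needed: the two `2`-dimensional Brauer characters of `SL₂(𝔽₄) ≅ A₅` differ on elements
of order `5`.

## Proof

`SL₂(𝔽₄) = ⟨a, b⟩`, `a = !![1,ω;0,1]` (order `2`), `b = !![0,1;1,1]` (order `3`), `(ab)⁵ = 1` — a
presentation of `A₅`; the 60 elements are the words `words60` (`sl4_words`).  (0) `det ∘ φ = 1`:
`b = u v` with involutions `u, v`, and `x² = 1 ⇒ x = 1` in `𝔽₁₆`.  (1) `φ b` has order `3` and
determinant `1`; every such element of `GL₂(𝔽₁₆)` is conjugate to `b` (`fact_conjB`, exhaustive over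
the `65 536` matrices).  (2) After conjugating so that `φ b = b`, `A = φ a` satisfies `A² = 1`, `A ≠ 1`,
`det A = 1`, `(A b)⁵ = 1`; the exhaustive `fact_conjA` says every such `A` is a `C(b)`-conjugate of `a`
or of `Frob(a) = !![1,ω²;0,1]` (there are `30` such `A`, `15 + 15`).  (3) Homomorphisms agreeing on
`a, b` agree (`hom_eq_of_ab`).  Closed computations by `decide` / `native_decide`
(axioms `propext`, `Classical.choice`, `Quot.sound`, `Lean.ofReduceBool`).  Data: unit
b2b-lgcu-subfield-g14, `emb4.py`.
-/

set_option linter.dupNamespace false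
set_option linter.style.longLine false

namespace Summit.MatrixMultiplication.MatrixMultiplication.Theorems.GradedDesignFamily.Negative.SubfieldSixteen

open Matrix

/-- `𝔽₄ = 𝔽₂[ω]/(ω² = 1 + ω)` (Mathlib's computable model; the model of the `q = 4` witness files). -/
abbrev K4 : Type := QuadraticAlgebra (ZMod 2) 1 1

/-- `X² + X + 1` is irreducible over `𝔽₂`, so `K4` is a field. -/
instance instFactK4 : Fact (∀ r : ZMod 2, r ^ 2 ≠ 1 + 1 * r) := ⟨by decide⟩

/-- `K4` is finite (via `K4 ≃ 𝔽₂ × 𝔽₂`). -/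
instance instFintypeK4 : Fintype K4 :=
  Fintype.ofEquiv _ (QuadraticAlgebra.equivProd (1 : ZMod 2) 1).symm

/-- `𝔽₁₆ = 𝔽₄[i]/(i² = ω + i)`. -/
abbrev K16 : Type := QuadraticAlgebra K4 ⟨0, 1⟩ 1

/-- `X² + X + ω` is irreducible over `𝔽₄`, so `K16` is a field. -/
instance instFactK16 : Fact (∀ r : K4, r ^ 2 ≠ ⟨0, 1⟩ + 1 * r) := ⟨by decide⟩

/-- `K16` is finite (via `K16 ≃ K4 × K4`). -/
instance instFintypeK16 : Fintype K16 :=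
  Fintype.ofEquiv _ (QuadraticAlgebra.equivProd (⟨0, 1⟩ : K4) 1).symm

/-- `|𝔽₄| = 4`. -/
theorem card_K4 : Fintype.card K4 = 4 := rfl

/-- `|𝔽₁₆| = 16`. -/
theorem card_K16 : Fintype.card K16 = 16 := rfl

/-- `2 × 2` matrices over `𝔽₁₆`. -/
abbrev Mat : Type := Matrix (Fin 2) (Fin 2) K16
/-- `H = SL₂(𝔽₄)`. -/
abbrev SL4 : Type := Matrix.SpecialLinearGroup (Fin 2) K4

/-! ### Generators, words, the Frobenius -/

/-- The involution `a = !![1, ω; 0, 1]`. -/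
def aSL : SL4 := ⟨!![1, ⟨0, 1⟩; 0, 1], by rw [Matrix.det_fin_two_of]; decide⟩
/-- The order-`3` generator `b = !![0, 1; 1, 1]`. -/
def bSL : SL4 := ⟨!![0, 1; 1, 1], by rw [Matrix.det_fin_two_of]; decide⟩
/-- `Frob(a) = !![1, ω²; 0, 1]`. -/
def faSL : SL4 := ⟨!![1, ⟨1, 1⟩; 0, 1], by rw [Matrix.det_fin_two_of]; decide⟩
/-- The involution `u = !![0, 1; 1, 0]`. -/
def uSL : SL4 := ⟨!![0, 1; 1, 0], by rw [Matrix.det_fin_two_of]; decide⟩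
/-- The involution `v = !![1, 1; 0, 1]` (`u v = b`). -/
def vSL : SL4 := ⟨!![1, 1; 0, 1], by rw [Matrix.det_fin_two_of]; decide⟩

/-- `a` over `𝔽₁₆`. -/
def aK : Mat := !![1, ⟨⟨0, 1⟩, 0⟩; 0, 1]
/-- `Frob(a)` over `𝔽₁₆`. -/
def faK : Mat := !![1, ⟨⟨1, 1⟩, 0⟩; 0, 1]
/-- `b` over `𝔽₁₆`. -/
def bK : Mat := !![0, 1; 1, 1]

/-- The entrywise embedding `SL₂(𝔽₄) → M₂(𝔽₁₆)` (as matrices). -/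
def phiM (h : SL4) : Mat := fun i j => ⟨(h : Matrix (Fin 2) (Fin 2) K4) i j, 0⟩

/-- `phiM` is the standard embedding `mapGL`, as matrices. -/
theorem phiM_eq (h : SL4) :
    phiM h = ((Matrix.SpecialLinearGroup.mapGL K16 h : GL (Fin 2) K16) : Mat) := by
  ext i j <;> simp [phiM, QuadraticAlgebra.algebraMap_eq]

/-- `mapGL a = aK`. -/
theorem mapGL_aSL : ((Matrix.SpecialLinearGroup.mapGL K16 aSL : GL (Fin 2) K16) : Mat) = aK := by
  rw [← phiM_eq]; decide

/-- `mapGL (Frob a) = faK`. -/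
theorem mapGL_faSL : ((Matrix.SpecialLinearGroup.mapGL K16 faSL : GL (Fin 2) K16) : Mat) = faK := by
  rw [← phiM_eq]; decide

/-- `mapGL b = bK`. -/
theorem mapGL_bSL : ((Matrix.SpecialLinearGroup.mapGL K16 bSL : GL (Fin 2) K16) : Mat) = bK := by
  rw [← phiM_eq]; decide

/-- The Frobenius `x ↦ x²` of `𝔽₄`, as a ring homomorphism (all four identities by `decide`). -/
def σ : K4 →+* K4 where
  toFun x := x * x
  map_one' := by decide
  map_mul' := by decide
  map_zero' := by decide
  map_add' := by decide

/-- `σ ∘ σ = id`. -/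
theorem σ_σ : ∀ x : K4, σ (σ x) = x := by decide

/-- The Frobenius twist `Frob : SL₂(𝔽₄) →* SL₂(𝔽₄)` (entrywise `σ`). -/
def frob : SL4 →* SL4 := Matrix.SpecialLinearGroup.map σ

/-- `Frob ∘ Frob = id`. -/
theorem frob_frob (h : SL4) : frob (frob h) = h :=
  Matrix.SpecialLinearGroup.ext _ _ fun _ _ => σ_σ _

/-- `Frob` is bijective. -/
theorem frob_bijective : Function.Bijective frob :=
  Function.Involutive.bijective frob_frob

/-- `Frob a = !![1, ω²; 0, 1]`. -/
theorem frob_aSL : frob aSL = faSL := Matrix.SpecialLinearGroup.ext _ _ (by decide)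

/-- `Frob b = b`. -/
theorem frob_bSL : frob bSL = bSL := Matrix.SpecialLinearGroup.ext _ _ (by decide)

/-- Evaluate a word (`false ↦ x`, `true ↦ y`). -/
def evalW {M : Type} [Monoid M] (x y : M) : List Bool → M
  | [] => 1
  | c :: w => (if c then y else x) * evalW x y w

/-- Words in `a, b` for the 60 elements of `SL₂(𝔽₄)` (breadth first). -/
def words60 : List (List Bool) :=
  [[], [false], [true], [false, true], [true, false], [true, true], [false, true, false], [false, true, true],
   [true, false, true], [true, true, false], [false, true, false, true], [false, true, true, false],
   [true, false, true, false], [true, false, true, true], [true, true, false, true],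
   [false, true, false, true, false], [false, true, false, true, true], [false, true, true, false, true],
   [true, false, true, false, true], [true, false, true, true, false], [true, true, false, true, false],
   [true, true, false, true, true], [false, true, false, true, true, false],
   [false, true, true, false, true, false], [true, false, true, false, true, false],
   [true, false, true, false, true, true], [true, false, true, true, false, true],
   [true, true, false, true, false, true], [true, true, false, true, true, false],
   [false, true, false, true, true, false, true], [false, true, true, false, true, false, true],
   [true, false, true, false, true, true, false], [true, false, true, true, false, true, false],
   [true, true, false, true, false, true, false], [true, true, false, true, false, true, true],
   [true, true, false, true, true, false, true], [false, true, false, true, true, false, true, false],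
   [false, true, true, false, true, false, true, false], [false, true, true, false, true, false, true, true],
   [true, false, true, false, true, true, false, true], [true, false, true, true, false, true, false, true],
   [true, true, false, true, false, true, true, false], [true, true, false, true, true, false, true, false],
   [false, true, false, true, true, false, true, false, true],
   [false, true, true, false, true, false, true, true, false],
   [true, false, true, false, true, true, false, true, false],
   [true, false, true, true, false, true, false, true, false],
   [true, false, true, true, false, true, false, true, true],
   [true, true, false, true, false, true, true, false, true],
   [true, true, false, true, true, false, true, false, true],
   [false, true, false, true, true, false, true, false, true, false],
   [false, true, false, true, true, false, true, false, true, true],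
   [false, true, true, false, true, false, true, true, false, true],
   [true, false, true, true, false, true, false, true, true, false],
   [true, true, false, true, false, true, true, false, true, false],
   [true, true, false, true, true, false, true, false, true, false],
   [false, true, false, true, true, false, true, false, true, true, false],
   [false, true, true, false, true, false, true, true, false, true, false],
   [true, false, true, true, false, true, false, true, true, false, true],
   [true, false, true, true, false, true, false, true, true, false, true, false]]

/-- Every element of `SL₂(𝔽₄)` is one of the 60 words. -/
theorem sl4_words : ∀ h : SL4, ∃ w ∈ words60, evalW aSL bSL w = h := by native_decide

/-- Homomorphisms commute with word evaluation. -/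
theorem map_evalW {M N : Type} [Monoid M] [Monoid N] (f : M →* N) (x y : M) (w : List Bool) :
    f (evalW x y w) = evalW (f x) (f y) w := by
  induction w with
  | nil => simp [evalW]
  | cons c w ih => cases c <;> simp [evalW, ih]

/-- Two homomorphisms out of `SL₂(𝔽₄)` that agree on `a` and `b` are equal. -/
theorem hom_eq_of_ab {N : Type} [Monoid N] (f g : SL4 →* N) (ha : f aSL = g aSL)
    (hb : f bSL = g bSL) : f = g := by
  ext h
  obtain ⟨w, -, rfl⟩ := sl4_words h
  rw [map_evalW, map_evalW, ha, hb]

/-! ### Exhaustive facts over `M₂(𝔽₁₆)` -/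

/-- `det`, written out. -/
def det2 (M : Mat) : K16 := M 0 0 * M 1 1 - M 0 1 * M 1 0

/-- `det2 = det`. -/
theorem det2_eq (M : Mat) : det2 M = M.det := by
  rw [Matrix.det_fin_two]; rfl

/-- In `𝔽₁₆` (odd unit group) `x² = 1 ⇒ x = 1`. -/
theorem sq_eq_one : ∀ x : K16, x * x = 1 → x = 1 := by native_decide

set_option maxHeartbeats 4000000 in
set_option synthInstance.maxHeartbeats 2000000 in
set_option synthInstance.maxSize 1000000 in
/-- **Exhaustive fact:** every element of `GL₂(𝔽₁₆)` of order `3` and determinant `1` is conjugate to `bK`. -/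
theorem fact_conjB : ∀ B : Mat, det2 B = 1 → B * B * B = 1 → B ≠ 1 →
    ∃ g : Mat, det2 g ≠ 0 ∧ g * bK = B * g := by
  native_decide

set_option maxHeartbeats 4000000 in
set_option synthInstance.maxHeartbeats 2000000 in
set_option synthInstance.maxSize 1000000 in
/-- **Exhaustive fact:** every `A ∈ SL₂(𝔽₁₆)` with `A² = 1`, `A ≠ 1`, `(A·bK)⁵ = 1` is a `C(bK)`-conjugate
of `aK` or of `faK` (there are exactly `30` such `A`, `15` of each kind). -/
theorem fact_conjA : ∀ A : Mat, det2 A = 1 → A * A = 1 → A ≠ 1 → (A * bK) ^ 5 = 1 →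
    ∃ g : Mat, det2 g ≠ 0 ∧ g * bK = bK * g ∧ (g * aK = A * g ∨ g * faK = A * g) := by
  native_decide

/-! ### The classification -/

/-- `det2` of an element of `GL₂(𝔽₁₆)` is non-zero. -/
theorem det2_coe_ne_zero (g : GL (Fin 2) K16) : det2 (g : Mat) ≠ 0 := by
  rw [det2_eq]
  exact ((Matrix.isUnit_iff_isUnit_det _).1 g.isUnit).ne_zero

/-- The image of an involution under any homomorphism `SL₂(𝔽₄) →* GL₂(𝔽₁₆)` has determinant `1`. -/
theorem det2_invol (φ : SL4 →* GL (Fin 2) K16) (u : SL4) (hu : u * u = 1) : det2 ((φ u : GL (Fin 2) K16) : Mat) = 1 := by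
  rw [det2_eq]
  apply sq_eq_one
  rw [← Matrix.det_mul, ← Units.val_mul, ← map_mul, hu, map_one, Units.val_one, Matrix.det_one]

/-- From a matrix identity `g * x = y * g` with `g` invertible to `y = G * x * G⁻¹` in `GL₂`. -/
theorem conj_of_eq (G x y : GL (Fin 2) K16) (h : (G : Mat) * (x : Mat) = (y : Mat) * (G : Mat)) :
    y = G * x * G⁻¹ := by
  have h' : G * x = y * G := Units.ext (by rw [Units.val_mul, Units.val_mul, h])
  rw [h', mul_inv_cancel_right]

/-- The relations of the generators (and `b = u v` with `u, v` involutions). -/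
theorem gen_rels : bSL * bSL * bSL = 1 ∧ bSL ≠ 1 ∧ aSL * aSL = 1 ∧ aSL ≠ 1 ∧ (aSL * bSL) ^ 5 = 1 ∧
    uSL * vSL = bSL ∧ uSL * uSL = 1 ∧ vSL * vSL = 1 := by
  native_decide

set_option maxHeartbeats 2000000 in
/-- **Every embedding `SL₂(𝔽₄) ↪ GL₂(𝔽₁₆)` is standard up to the Frobenius of `𝔽₄`.** -/
theorem embedding_conj (φ : SL4 →* GL (Fin 2) K16) (hφ : Function.Injective φ) :
    ∃ g : GL (Fin 2) K16, ∃ τ : SL4 →* SL4, Function.Bijective τ ∧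
      ∀ a : SL4, φ a = g * Matrix.SpecialLinearGroup.mapGL K16 (τ a) * g⁻¹ := by
  obtain ⟨hb3, hb1, ha2, ha1, hab, huv, hu2, hv2⟩ := gen_rels
  have hval : ∀ (x : GL (Fin 2) K16) (n : ℕ), ((x ^ n : GL (Fin 2) K16) : Mat) = (x : Mat) ^ n :=
    fun x n => Units.val_pow_eq_pow_val x n
  -- step 1: conjugate `φ b` to `bK`
  set B := φ bSL with hBdef
  have hBdet : det2 (B : Mat) = 1 := by
    rw [hBdef, ← huv, map_mul, Units.val_mul, det2_eq, Matrix.det_mul, ← det2_eq, ← det2_eq,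
      det2_invol φ uSL hu2, det2_invol φ vSL hv2, mul_one]
  have hB3 : (B : Mat) * B * B = 1 := by
    have h := congrArg (fun x : GL (Fin 2) K16 => (x : Mat)) (show B * B * B = 1 by
      rw [hBdef, ← map_mul, ← map_mul, hb3, map_one])
    simpa using h
  have hB1 : (B : Mat) ≠ 1 := by
    intro h
    apply hb1
    apply hφ
    rw [map_one]
    exact Units.ext h
  obtain ⟨g₁, hg₁, hg₁b⟩ := fact_conjB (B : Mat) hBdet hB3 hB1
  let G₁ : GL (Fin 2) K16 := Matrix.GeneralLinearGroup.mkOfDetNeZero (g₁ : Mat) (by rw [← det2_eq]; exact hg₁)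
  have hG₁ : (G₁ : Mat) = g₁ := rfl
  let φ₁ : SL4 →* GL (Fin 2) K16 := (MulAut.conj G₁⁻¹).toMonoidHom.comp φ
  have hφ₁ : ∀ a, φ₁ a = G₁⁻¹ * φ a * G₁ := by
    intro a; simp [φ₁]
  have hφ₁inj : Function.Injective φ₁ := (MulAut.conj G₁⁻¹).injective.comp hφ
  have hφ₁b : φ₁ bSL = Matrix.SpecialLinearGroup.mapGL K16 bSL := by
    have h1 : B = G₁ * Matrix.SpecialLinearGroup.mapGL K16 bSL * G₁⁻¹ :=
      conj_of_eq G₁ _ _ (by rw [mapGL_bSL, hG₁]; exact hg₁b)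
    rw [hφ₁, ← hBdef, h1]
    group
  -- step 2: the image of `a`
  set A := φ₁ aSL with hAdef
  have hAdet : det2 (A : Mat) = 1 := det2_invol φ₁ aSL ha2
  have hA2 : (A : Mat) * A = 1 := by
    have h := congrArg (fun x : GL (Fin 2) K16 => (x : Mat)) (show A * A = 1 by
      rw [hAdef, ← map_mul, ha2, map_one])
    simpa using h
  have hA1 : (A : Mat) ≠ 1 := by
    intro h
    apply ha1
    apply hφ₁inj
    rw [map_one]
    exact Units.ext h
  have hAb : ((A : Mat) * bK) ^ 5 = 1 := by
    rw [← mapGL_bSL, ← hφ₁b, ← Units.val_mul, ← hval, hAdef, ← map_mul, ← map_pow, hab, map_one,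
      Units.val_one]
  obtain ⟨g₂, hg₂, hg₂b, hg₂a⟩ := fact_conjA (A : Mat) hAdet hA2 hA1 hAb
  let G₂ : GL (Fin 2) K16 := Matrix.GeneralLinearGroup.mkOfDetNeZero (g₂ : Mat) (by rw [← det2_eq]; exact hg₂)
  have hG₂ : (G₂ : Mat) = g₂ := rfl
  have hbconj : φ₁ bSL = G₂ * Matrix.SpecialLinearGroup.mapGL K16 bSL * G₂⁻¹ := by
    rw [hφ₁b]
    exact conj_of_eq G₂ _ _ (by rw [mapGL_bSL, hG₂]; exact hg₂b)
  -- step 3: the twist `τ` and the comparison on generators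
  obtain ⟨τ, hτbij, hτa, hτb⟩ : ∃ τ : SL4 →* SL4, Function.Bijective τ ∧
      (g₂ : Mat) * ((Matrix.SpecialLinearGroup.mapGL K16 (τ aSL) : GL (Fin 2) K16) : Mat) = (A : Mat) * g₂ ∧
      τ bSL = bSL := by
    rcases hg₂a with h | h
    · exact ⟨MonoidHom.id _, Function.bijective_id, by rw [MonoidHom.id_apply, mapGL_aSL]; exact h, rfl⟩
    · exact ⟨frob, frob_bijective, by rw [frob_aSL, mapGL_faSL]; exact h, frob_bSL⟩
  let ψ : SL4 →* GL (Fin 2) K16 :=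
    ((MulAut.conj G₂).toMonoidHom.comp (Matrix.SpecialLinearGroup.mapGL K16)).comp τ
  have hψ : ∀ a, ψ a = G₂ * Matrix.SpecialLinearGroup.mapGL K16 (τ a) * G₂⁻¹ := by
    intro a; simp [ψ, MulAut.conj_apply]
  have heq : φ₁ = ψ := by
    apply hom_eq_of_ab
    · rw [hψ, ← hAdef]
      exact conj_of_eq G₂ _ _ (by rw [hG₂]; exact hτa)
    · rw [hψ, hτb, hbconj]
  refine ⟨G₁ * G₂, τ, hτbij, fun a => ?_⟩
  have h1 : φ a = G₁ * φ₁ a * G₁⁻¹ := by rw [hφ₁]; group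
  rw [h1, heq, hψ]
  group

end Summit.MatrixMultiplication.MatrixMultiplication.Theorems.GradedDesignFamily.Negative.SubfieldSixteen
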